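import Literature.Analysis.OperatorTheory.PowerIterationRatioLimit
import HarnessLib

/-!
# Transfer-operator covariances: uniform exponential decay and bulk convergence (abstract part)

Helper file for item `stmt-AtomisticToContinuum-12398` (`SpecificHeatLimit`, route `HeatModeWeylLaw`
of `AtomisticToContinuum/FouriersLaw`). Pure real-Hilbert-space bookkeeping behind the
transfer-operator computation of the energy variance of a one-dimensional chain. Setting: a bounded
operator `At` (the transfer operator divided by its top eigenvalue) with a unit vector `φ`,
`At φ = φ`, whose powers converge to the rank-one projection `Π g = ⟪φ, g⟫ φ` at a geometric rate
`‖Atʲ g - ⟪φ, g⟫ φ‖ ≤ rʲ ‖g‖` (`0 ≤ r ≤ 1`; supplied by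
`Literature.Analysis.OperatorTheory.IsPositivityImproving.exists_norm_pow_sub_le`), and a bounded
"insertion" operator `H`. For vectors `u, w` (normalised left/right boundary iterates) the four
matrix elements
`T₁ = ⟪u, H Atᵍ H w⟫, T₂ = ⟪u, H Atᵍ⁺¹ w⟫, T₃ = ⟪u, Atᵍ⁺¹ H w⟫, T₄ = ⟪u, Atᵍ⁺² w⟫`
are the un-normalised two-point function, the two one-point functions and the partition function of
two bond observables at distance `g + 1`; the finite-volume covariance is `(T₁ T₄ - T₂ T₃)/T₄²`.

* `abs_det_le` — **uniform exponential decay**: `|T₁ T₄ - T₂ T₃| ≤ 6 ‖H‖² ‖u‖² ‖w‖² rᵍ`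
  (the rank-one parts cancel exactly in the determinant);
* `abs_inner_sub_sq_inner_le` — continuity of `⟪u, M w⟫` at `(cφ, cφ)`;
* `norm_pow_apply_le_two_mul`, `pow_apply_eq_self` — `‖Atʲ g‖ ≤ 2‖g‖`, `Atʲ φ = φ`;
* `abs_div_sub_div_le`, `abs_sq_sub_sq_le` — quotient bookkeeping.

All [folklore]; Mathlib + `PowerIterationRatioLimit` (`abs_inner_apply_sub_inner_apply_le`) only;
no definitions.
-/

noncomputable section

open Filter Topology
open scoped RealInnerProductSpace

namespace Summit.AtomisticToContinuum.FouriersLaw.Theorems.SpecificHeatLimit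

open Literature.Analysis.OperatorTheory

/-! ### Quotient bookkeeping -/

/-- `|x/y - x'/y'| ≤ |x - x'|/z + |x'| |y - y'|/z²` for `y, y' ≥ z > 0`. [folklore] -/
theorem abs_div_sub_div_le {x x' y y' z : ℝ} (hz : 0 < z) (hy : z ≤ y) (hy' : z ≤ y') :
    |x / y - x' / y'| ≤ |x - x'| / z + |x'| * |y - y'| / z ^ 2 := by
  have hy0 : 0 < y := hz.trans_le hy
  have hy'0 : 0 < y' := hz.trans_le hy'
  have h : x / y - x' / y' = (x - x') / y + x' * (y' - y) / (y * y') := by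
    field_simp
    ring
  rw [h]
  refine (abs_add_le _ _).trans (add_le_add ?_ ?_)
  · rw [abs_div, abs_of_pos hy0]
    exact div_le_div_of_nonneg_left (abs_nonneg _) hz hy
  · rw [abs_div, abs_mul, abs_of_pos (mul_pos hy0 hy'0), abs_sub_comm]
    refine div_le_div₀ (by positivity) le_rfl (by positivity) ?_
    rw [sq]
    exact mul_le_mul hy hy' hz.le hy0.le

/-- `|y² - y'²| ≤ (|y| + |y'|) |y - y'|`. [folklore] -/
theorem abs_sq_sub_sq_le (y y' : ℝ) : |y ^ 2 - y' ^ 2| ≤ (|y| + |y'|) * |y - y'| := by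
  rw [sq_sub_sq, abs_mul]
  gcongr
  exact abs_add_le _ _

/-! ### Normalised transfer operator: iterates -/

section Operator

variable {E : Type*} [NormedAddCommGroup E] [InnerProductSpace ℝ E]
  {At H : E →L[ℝ] E} {φ : E} {r : ℝ}

/-- `Atʲ φ = φ` when `At φ = φ`. [folklore] -/
theorem pow_apply_eq_self (hAtφ : At φ = φ) (j : ℕ) : (At ^ j) φ = φ := by
  induction j with
  | zero => simp
  | succ j ih => rw [pow_succ, mul_apply_eq_comp, hAtφ, ih]

/-- `‖Atʲ g‖ ≤ 2 ‖g‖` from the geometric convergence to the rank-one projection (`r ≤ 1`,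
`‖φ‖ = 1`). [folklore] -/
theorem norm_pow_apply_le_two_mul (hφ : ‖φ‖ = 1) (hr0 : 0 ≤ r) (hr1 : r ≤ 1)
    (hpow : ∀ (j : ℕ) (g : E), ‖(At ^ j) g - ⟪φ, g⟫ • φ‖ ≤ r ^ j * ‖g‖) (j : ℕ) (g : E) :
    ‖(At ^ j) g‖ ≤ 2 * ‖g‖ := by
  have h1 : ‖⟪φ, g⟫ • φ‖ ≤ ‖g‖ := by
    rw [norm_smul, hφ, mul_one, Real.norm_eq_abs]
    calc |⟪φ, g⟫| ≤ ‖φ‖ * ‖g‖ := abs_real_inner_le_norm _ _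
      _ = ‖g‖ := by rw [hφ, one_mul]
  calc ‖(At ^ j) g‖ = ‖((At ^ j) g - ⟪φ, g⟫ • φ) + ⟪φ, g⟫ • φ‖ := by rw [sub_add_cancel]
    _ ≤ ‖(At ^ j) g - ⟪φ, g⟫ • φ‖ + ‖⟪φ, g⟫ • φ‖ := norm_add_le _ _
    _ ≤ r ^ j * ‖g‖ + ‖g‖ := add_le_add (hpow j g) h1
    _ ≤ 1 * ‖g‖ + ‖g‖ := by gcongr; exact pow_le_one₀ hr0 hr1
    _ = 2 * ‖g‖ := by ring

/-- The remainder pairing: `|⟪u, M (Atʲ v)⟫ - ⟪φ, v⟫ ⟪u, M φ⟫| ≤ ‖u‖ ‖M‖ rʲ ‖v‖`. [folklore] -/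
theorem abs_inner_apply_pow_sub_le
    (hpow : ∀ (j : ℕ) (g : E), ‖(At ^ j) g - ⟪φ, g⟫ • φ‖ ≤ r ^ j * ‖g‖) (M : E →L[ℝ] E)
    (j : ℕ) (u v : E) :
    |⟪u, M ((At ^ j) v)⟫ - ⟪φ, v⟫ * ⟪u, M φ⟫| ≤ ‖u‖ * ‖M‖ * (r ^ j * ‖v‖) := by
  have h : ⟪u, M ((At ^ j) v)⟫ - ⟪φ, v⟫ * ⟪u, M φ⟫ = ⟪u, M ((At ^ j) v - ⟪φ, v⟫ • φ)⟫ := by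
    rw [map_sub, map_smul, inner_sub_right, real_inner_smul_right]
  rw [h]
  calc |⟪u, M ((At ^ j) v - ⟪φ, v⟫ • φ)⟫| ≤ ‖u‖ * ‖M ((At ^ j) v - ⟪φ, v⟫ • φ)‖ :=
        abs_real_inner_le_norm _ _
    _ ≤ ‖u‖ * (‖M‖ * ‖(At ^ j) v - ⟪φ, v⟫ • φ‖) := by gcongr; exact M.le_opNorm _
    _ ≤ ‖u‖ * (‖M‖ * (r ^ j * ‖v‖)) := by gcongr; exact hpow j v
    _ = ‖u‖ * ‖M‖ * (r ^ j * ‖v‖) := by ring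

/-- **Uniform exponential decay of the covariance determinant.** With
`T₁ = ⟪u, H Atᵍ H w⟫, T₂ = ⟪u, H Atᵍ⁺¹ w⟫, T₃ = ⟪u, Atᵍ⁺¹ H w⟫, T₄ = ⟪u, Atᵍ⁺² w⟫`:
`|T₁ T₄ - T₂ T₃| ≤ 6 ‖H‖² ‖u‖² ‖w‖² rᵍ` — writing `Atʲ = Π + Rⱼ` with `Π v = ⟪φ, v⟫ φ` and
`‖Rⱼ‖ ≤ rʲ`, the `Π Π`-terms of `T₁T₄` and `T₂T₃` coincide, and every remaining term carries a factor
`rᵍ`. This is the finite-volume, boundary-uniform exponential clustering of bond observables of a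
one-dimensional chain with a transfer-operator gap. [folklore] -/
theorem abs_det_le (hφ : ‖φ‖ = 1) (hr0 : 0 ≤ r) (hr1 : r ≤ 1)
    (hpow : ∀ (j : ℕ) (g : E), ‖(At ^ j) g - ⟪φ, g⟫ • φ‖ ≤ r ^ j * ‖g‖) (g : ℕ) (u w : E) :
    |⟪u, H ((At ^ g) (H w))⟫ * ⟪u, (At ^ (g + 2)) w⟫ -
        ⟪u, H ((At ^ (g + 1)) w)⟫ * ⟪u, (At ^ (g + 1)) (H w)⟫| ≤
      6 * ‖H‖ ^ 2 * ‖u‖ ^ 2 * ‖w‖ ^ 2 * r ^ g := by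
  -- the four rank-one parts and the four remainders
  set α : ℝ := ⟪u, H φ⟫ with hα
  set β : ℝ := ⟪φ, H w⟫ with hβ
  set γ : ℝ := ⟪u, φ⟫ with hγ
  set δ : ℝ := ⟪φ, w⟫ with hδ
  set ε₁ : ℝ := ⟪u, H ((At ^ g) (H w))⟫ - β * α with hε₁
  set ε₂ : ℝ := ⟪u, H ((At ^ (g + 1)) w)⟫ - δ * α with hε₂
  set ε₃ : ℝ := ⟪u, (At ^ (g + 1)) (H w)⟫ - β * γ with hε₃
  set ε₄ : ℝ := ⟪u, (At ^ (g + 2)) w⟫ - δ * γ with hε₄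
  have hrg : ∀ k, r ^ (g + k) ≤ r ^ g := fun k => pow_le_pow_of_le_one hr0 hr1 (by omega)
  have hrg1 : r ^ g ≤ 1 := pow_le_one₀ hr0 hr1
  have hHw : ‖H w‖ ≤ ‖H‖ * ‖w‖ := H.le_opNorm w
  -- bounds on the remainders
  have h1 : |ε₁| ≤ ‖H‖ ^ 2 * ‖u‖ * ‖w‖ * r ^ g := by
    have h := abs_inner_apply_pow_sub_le hpow H g u (H w)
    rw [← hβ, ← hα] at h
    calc |ε₁| ≤ ‖u‖ * ‖H‖ * (r ^ g * ‖H w‖) := h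
      _ ≤ ‖u‖ * ‖H‖ * (r ^ g * (‖H‖ * ‖w‖)) := by gcongr
      _ = ‖H‖ ^ 2 * ‖u‖ * ‖w‖ * r ^ g := by ring
  have h2 : |ε₂| ≤ ‖H‖ * ‖u‖ * ‖w‖ * r ^ g := by
    have h := abs_inner_apply_pow_sub_le hpow H (g + 1) u w
    rw [← hδ, ← hα] at h
    calc |ε₂| ≤ ‖u‖ * ‖H‖ * (r ^ (g + 1) * ‖w‖) := h
      _ ≤ ‖u‖ * ‖H‖ * (r ^ g * ‖w‖) :=
          mul_le_mul_of_nonneg_left (mul_le_mul_of_nonneg_right (hrg 1) (norm_nonneg _))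
            (by positivity)
      _ = ‖H‖ * ‖u‖ * ‖w‖ * r ^ g := by ring
  have h3 : |ε₃| ≤ ‖H‖ * ‖u‖ * ‖w‖ * r ^ g := by
    have h := abs_inner_apply_pow_sub_le hpow (1 : E →L[ℝ] E) (g + 1) u (H w)
    simp only [one_apply_eq_self] at h
    rw [← hβ, ← hγ] at h
    calc |ε₃| ≤ ‖u‖ * ‖(1 : E →L[ℝ] E)‖ * (r ^ (g + 1) * ‖H w‖) := h
      _ ≤ ‖u‖ * 1 * (r ^ g * (‖H‖ * ‖w‖)) := by
          refine mul_le_mul ?_ ?_ (by positivity) (by positivity)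
          · exact mul_le_mul_of_nonneg_left ContinuousLinearMap.norm_id_le (norm_nonneg _)
          · exact mul_le_mul (hrg 1) hHw (norm_nonneg _) (pow_nonneg hr0 _)
      _ = ‖H‖ * ‖u‖ * ‖w‖ * r ^ g := by ring
  have h4 : |ε₄| ≤ ‖u‖ * ‖w‖ * r ^ g := by
    have h := abs_inner_apply_pow_sub_le hpow (1 : E →L[ℝ] E) (g + 2) u w
    simp only [one_apply_eq_self] at h
    rw [← hδ, ← hγ] at h
    calc |ε₄| ≤ ‖u‖ * ‖(1 : E →L[ℝ] E)‖ * (r ^ (g + 2) * ‖w‖) := h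
      _ ≤ ‖u‖ * 1 * (r ^ g * ‖w‖) := by
          refine mul_le_mul ?_ ?_ (by positivity) (by positivity)
          · exact mul_le_mul_of_nonneg_left ContinuousLinearMap.norm_id_le (norm_nonneg _)
          · exact mul_le_mul_of_nonneg_right (hrg 2) (norm_nonneg _)
      _ = ‖u‖ * ‖w‖ * r ^ g := by ring
  -- bounds on the rank-one coefficients
  have hαb : |α| ≤ ‖H‖ * ‖u‖ := by
    calc |α| ≤ ‖u‖ * ‖H φ‖ := abs_real_inner_le_norm _ _
      _ ≤ ‖u‖ * (‖H‖ * ‖φ‖) := by gcongr; exact H.le_opNorm φ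
      _ = ‖H‖ * ‖u‖ := by rw [hφ]; ring
  have hβb : |β| ≤ ‖H‖ * ‖w‖ := by
    calc |β| ≤ ‖φ‖ * ‖H w‖ := abs_real_inner_le_norm _ _
      _ ≤ 1 * (‖H‖ * ‖w‖) := by rw [hφ]; gcongr
      _ = ‖H‖ * ‖w‖ := by ring
  have hγb : |γ| ≤ ‖u‖ := by
    calc |γ| ≤ ‖u‖ * ‖φ‖ := abs_real_inner_le_norm _ _
      _ = ‖u‖ := by rw [hφ, mul_one]
  have hδb : |δ| ≤ ‖w‖ := by
    calc |δ| ≤ ‖φ‖ * ‖w‖ := abs_real_inner_le_norm _ _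
      _ = ‖w‖ := by rw [hφ, one_mul]
  -- the determinant
  have hdet : ⟪u, H ((At ^ g) (H w))⟫ * ⟪u, (At ^ (g + 2)) w⟫ -
      ⟪u, H ((At ^ (g + 1)) w)⟫ * ⟪u, (At ^ (g + 1)) (H w)⟫ =
      β * α * ε₄ + δ * γ * ε₁ + ε₁ * ε₄ - δ * α * ε₃ - β * γ * ε₂ - ε₂ * ε₃ := by
    have e1 : ⟪u, H ((At ^ g) (H w))⟫ = β * α + ε₁ := by rw [hε₁]; ring
    have e2 : ⟪u, H ((At ^ (g + 1)) w)⟫ = δ * α + ε₂ := by rw [hε₂]; ring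
    have e3 : ⟪u, (At ^ (g + 1)) (H w)⟫ = β * γ + ε₃ := by rw [hε₃]; ring
    have e4 : ⟪u, (At ^ (g + 2)) w⟫ = δ * γ + ε₄ := by rw [hε₄]; ring
    rw [e1, e2, e3, e4]
    ring
  rw [hdet]
  -- six terms, each `≤ ‖H‖² ‖u‖² ‖w‖² rᵍ`
  set Q : ℝ := ‖H‖ ^ 2 * ‖u‖ ^ 2 * ‖w‖ ^ 2 * r ^ g with hQ
  have hQ0 : 0 ≤ Q := by positivity
  have t1 : |β * α * ε₄| ≤ Q := by
    rw [abs_mul, abs_mul]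
    calc |β| * |α| * |ε₄| ≤ ‖H‖ * ‖w‖ * (‖H‖ * ‖u‖) * (‖u‖ * ‖w‖ * r ^ g) := by
          gcongr
      _ = Q := by rw [hQ]; ring
  have t2 : |δ * γ * ε₁| ≤ Q := by
    rw [abs_mul, abs_mul]
    calc |δ| * |γ| * |ε₁| ≤ ‖w‖ * ‖u‖ * (‖H‖ ^ 2 * ‖u‖ * ‖w‖ * r ^ g) := by gcongr
      _ = Q := by rw [hQ]; ring
  have t3 : |ε₁ * ε₄| ≤ Q := by
    rw [abs_mul]
    calc |ε₁| * |ε₄| ≤ ‖H‖ ^ 2 * ‖u‖ * ‖w‖ * r ^ g * (‖u‖ * ‖w‖ * r ^ g) := by gcongr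
      _ = Q * r ^ g := by rw [hQ]; ring
      _ ≤ Q * 1 := by gcongr
      _ = Q := mul_one Q
  have t4 : |δ * α * ε₃| ≤ Q := by
    rw [abs_mul, abs_mul]
    calc |δ| * |α| * |ε₃| ≤ ‖w‖ * (‖H‖ * ‖u‖) * (‖H‖ * ‖u‖ * ‖w‖ * r ^ g) := by gcongr
      _ = Q := by rw [hQ]; ring
  have t5 : |β * γ * ε₂| ≤ Q := by
    rw [abs_mul, abs_mul]
    calc |β| * |γ| * |ε₂| ≤ ‖H‖ * ‖w‖ * ‖u‖ * (‖H‖ * ‖u‖ * ‖w‖ * r ^ g) := by gcongr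
      _ = Q := by rw [hQ]; ring
  have t6 : |ε₂ * ε₃| ≤ Q := by
    rw [abs_mul]
    calc |ε₂| * |ε₃| ≤ ‖H‖ * ‖u‖ * ‖w‖ * r ^ g * (‖H‖ * ‖u‖ * ‖w‖ * r ^ g) := by gcongr
      _ = Q * r ^ g := by rw [hQ]; ring
      _ ≤ Q * 1 := by gcongr
      _ = Q := mul_one Q
  calc |β * α * ε₄ + δ * γ * ε₁ + ε₁ * ε₄ - δ * α * ε₃ - β * γ * ε₂ - ε₂ * ε₃|
      ≤ |β * α * ε₄| + |δ * γ * ε₁| + |ε₁ * ε₄| + |δ * α * ε₃| + |β * γ * ε₂| + |ε₂ * ε₃| := by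
        refine (abs_sub _ _).trans (add_le_add ((abs_sub _ _).trans (add_le_add
          ((abs_sub _ _).trans (add_le_add ((abs_add_le _ _).trans (add_le_add
          (abs_add_le _ _) le_rfl)) le_rfl)) le_rfl)) le_rfl)
    _ ≤ Q + Q + Q + Q + Q + Q := by gcongr
    _ = 6 * ‖H‖ ^ 2 * ‖u‖ ^ 2 * ‖w‖ ^ 2 * r ^ g := by rw [hQ]; ring

/-- Continuity of a matrix element at `(cφ, cφ)`:
`|⟪u, M w⟫ - c² ⟪φ, M φ⟫| ≤ ‖M‖ (‖u - cφ‖ ‖w‖ + |c| ‖w - cφ‖)` (`‖φ‖ = 1`). [folklore] -/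
theorem abs_inner_sub_sq_inner_le (hφ : ‖φ‖ = 1) (M : E →L[ℝ] E) (c : ℝ) (u w : E) :
    |⟪u, M w⟫ - c ^ 2 * ⟪φ, M φ⟫| ≤ ‖M‖ * (‖u - c • φ‖ * ‖w‖ + |c| * ‖w - c • φ‖) := by
  have h := abs_inner_apply_sub_inner_apply_le M u (c • φ) w (c • φ)
  have e : ⟪c • φ, M (c • φ)⟫ = c ^ 2 * ⟪φ, M φ⟫ := by
    rw [map_smul, real_inner_smul_left, real_inner_smul_right]; ring
  rw [e] at h
  have hn : ‖c • φ‖ = |c| := by rw [norm_smul, hφ, mul_one, Real.norm_eq_abs]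
  rwa [hn] at h

/-- `⟪Atʲ x, y⟫ = ⟪x, Atʲ y⟫` for a symmetric `At`. [folklore] -/
theorem inner_pow_apply_comm (hsym : ∀ x y : E, ⟪At x, y⟫ = ⟪x, At y⟫) (j : ℕ) (x y : E) :
    ⟪(At ^ j) x, y⟫ = ⟪x, (At ^ j) y⟫ := by
  induction j generalizing x y with
  | zero => simp
  | succ j ih => rw [pow_succ', mul_apply_eq_comp, mul_apply_eq_comp, hsym, ih]; rw [← mul_apply_eq_comp,
      ← mul_apply_eq_comp, ← pow_succ, ← pow_succ']

/-- The operator norm of the powers: `‖Atʲ‖ ≤ 2`. [folklore] -/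
theorem norm_pow_le_two (hφ : ‖φ‖ = 1) (hr0 : 0 ≤ r) (hr1 : r ≤ 1)
    (hpow : ∀ (j : ℕ) (g : E), ‖(At ^ j) g - ⟪φ, g⟫ • φ‖ ≤ r ^ j * ‖g‖) (j : ℕ) :
    ‖At ^ j‖ ≤ 2 :=
  ContinuousLinearMap.opNorm_le_bound _ (by norm_num) (norm_pow_apply_le_two_mul hφ hr0 hr1 hpow j)

/-- **Bulk convergence of a ratio of matrix elements.** For `‖M‖ ≤ B_M`, boundary iterates `u, w`
with `‖u - cφ‖ ≤ δu`, `‖w - cφ‖ ≤ δw`, `‖u‖, ‖w‖, |c| ≤ U`, and a partition function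
`⟪u, Atʲ w⟫ ≥ z_* > 0` with `c² ≥ z_*`:
`|⟪u, M w⟫ / ⟪u, Atʲ w⟫ - ⟪φ, M φ⟫| ≤ (B_M U / z_* + 2 U³ B_M / z_*²) (δu + δw)` — the finite-volume
expectation of the insertion `M` converges to its infinite-volume value `⟪φ, M φ⟫` as both boundaries
recede. [folklore] -/
theorem abs_ratio_sub_le (hφ : ‖φ‖ = 1) (hr0 : 0 ≤ r) (hr1 : r ≤ 1)
    (hpow : ∀ (j : ℕ) (g : E), ‖(At ^ j) g - ⟪φ, g⟫ • φ‖ ≤ r ^ j * ‖g‖) (hAtφ : At φ = φ)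
    {M : E →L[ℝ] E} {BM : ℝ} (hM : ‖M‖ ≤ BM) (j : ℕ) {u w : E} {c δu δw U zs : ℝ} (hzs : 0 < zs)
    (hδu : ‖u - c • φ‖ ≤ δu) (hδw : ‖w - c • φ‖ ≤ δw) (hu : ‖u‖ ≤ U) (hw : ‖w‖ ≤ U) (hc : |c| ≤ U)
    (hzc : zs ≤ c ^ 2) (hT : zs ≤ ⟪u, (At ^ j) w⟫) :
    |⟪u, M w⟫ / ⟪u, (At ^ j) w⟫ - ⟪φ, M φ⟫| ≤
      (BM * U / zs + U ^ 2 * BM * (2 * U) / zs ^ 2) * (δu + δw) := by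
  have hU : 0 ≤ U := (norm_nonneg _).trans hu
  have hδu0 : 0 ≤ δu := (norm_nonneg _).trans hδu
  have hδw0 : 0 ≤ δw := (norm_nonneg _).trans hδw
  have hBM : 0 ≤ BM := (norm_nonneg _).trans hM
  have hc2 : 0 < c ^ 2 := hzs.trans_le hzc
  -- numerator
  have hx : |⟪u, M w⟫ - c ^ 2 * ⟪φ, M φ⟫| ≤ BM * U * (δu + δw) := by
    calc |⟪u, M w⟫ - c ^ 2 * ⟪φ, M φ⟫| ≤ ‖M‖ * (‖u - c • φ‖ * ‖w‖ + |c| * ‖w - c • φ‖) :=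
          abs_inner_sub_sq_inner_le hφ M c u w
      _ ≤ BM * (δu * U + U * δw) := by gcongr
      _ = BM * U * (δu + δw) := by ring
  -- denominator
  have hy : |⟪u, (At ^ j) w⟫ - c ^ 2| ≤ 2 * U * (δu + δw) := by
    have h := abs_inner_sub_sq_inner_le hφ (At ^ j) c u w
    rw [pow_apply_eq_self hAtφ, real_inner_self_eq_norm_sq, hφ, one_pow, mul_one] at h
    calc |⟪u, (At ^ j) w⟫ - c ^ 2| ≤ ‖At ^ j‖ * (‖u - c • φ‖ * ‖w‖ + |c| * ‖w - c • φ‖) := h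
      _ ≤ 2 * (δu * U + U * δw) := by gcongr; exact norm_pow_le_two hφ hr0 hr1 hpow j
      _ = 2 * U * (δu + δw) := by ring
  have hx' : |c ^ 2 * ⟪φ, M φ⟫| ≤ U ^ 2 * BM := by
    rw [abs_mul, abs_of_pos hc2]
    have h1 : c ^ 2 ≤ U ^ 2 := by
      calc c ^ 2 = |c| ^ 2 := (sq_abs c).symm
        _ ≤ U ^ 2 := by gcongr
    have h2 : |⟪φ, M φ⟫| ≤ BM := by
      calc |⟪φ, M φ⟫| ≤ ‖φ‖ * ‖M φ‖ := abs_real_inner_le_norm _ _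
        _ ≤ ‖φ‖ * (‖M‖ * ‖φ‖) := by gcongr; exact M.le_opNorm φ
        _ = ‖M‖ := by rw [hφ]; ring
        _ ≤ BM := hM
    exact mul_le_mul h1 h2 (abs_nonneg _) (by positivity)
  have hmain := abs_div_sub_div_le (x := ⟪u, M w⟫) (x' := c ^ 2 * ⟪φ, M φ⟫) hzs hT hzc
  have e : c ^ 2 * ⟪φ, M φ⟫ / c ^ 2 = ⟪φ, M φ⟫ := mul_div_cancel_left₀ _ hc2.ne'
  rw [e] at hmain
  calc |⟪u, M w⟫ / ⟪u, (At ^ j) w⟫ - ⟪φ, M φ⟫|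
      ≤ |⟪u, M w⟫ - c ^ 2 * ⟪φ, M φ⟫| / zs +
          |c ^ 2 * ⟪φ, M φ⟫| * |⟪u, (At ^ j) w⟫ - c ^ 2| / zs ^ 2 := hmain
    _ ≤ BM * U * (δu + δw) / zs + U ^ 2 * BM * (2 * U * (δu + δw)) / zs ^ 2 := by gcongr
    _ = (BM * U / zs + U ^ 2 * BM * (2 * U) / zs ^ 2) * (δu + δw) := by ring

/-- A crude bound on a ratio of matrix elements: `|⟪u, M w⟫ / T| ≤ B_M U² / z_*` for `T ≥ z_*`.
[folklore] -/
theorem abs_ratio_le {M : E →L[ℝ] E} {BM : ℝ} (hM : ‖M‖ ≤ BM) {u w : E} {U zs T : ℝ}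
    (hzs : 0 < zs) (hu : ‖u‖ ≤ U) (hw : ‖w‖ ≤ U) (hT : zs ≤ T) :
    |⟪u, M w⟫ / T| ≤ BM * U ^ 2 / zs := by
  have hU : 0 ≤ U := (norm_nonneg _).trans hu
  have hBM : 0 ≤ BM := (norm_nonneg _).trans hM
  rw [abs_div, abs_of_pos (hzs.trans_le hT)]
  refine div_le_div₀ (by positivity) ?_ hzs hT
  calc |⟪u, M w⟫| ≤ ‖u‖ * ‖M w‖ := abs_real_inner_le_norm _ _
    _ ≤ ‖u‖ * (‖M‖ * ‖w‖) := by gcongr; exact M.le_opNorm w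
    _ ≤ U * (BM * U) := by gcongr
    _ = BM * U ^ 2 := by ring

end Operator

end Summit.AtomisticToContinuum.FouriersLaw.Theorems.SpecificHeatLimit

end
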